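import Summits.QuantumAdvantage.QuantumAdvantage.Theorems.LinnikCubicClassGroupsDegreeOnePrimesEscapeFrobeniusSmoothed
import Literature.NumberTheory.LFunctions.RayClassLSeriesNonvanishingLineProofs
import Literature.NumberTheory.LFunctions.LogDerivRectangleResidues
import HarnessLib

/-!
# The exceptional index of a cyclic Hecke factorisation is real (`2 j₀ ∈ {0, m}`)

Topic `Summits/QuantumAdvantage/QuantumAdvantage/Theorems`, cell B2b-1 (linnik-cubic), PART A (gen 13); helper
toward the crux `DegreeOnePrimesEscape` (stmt-QuantumAdvantage-11543) — step B6 of the LMO programme for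
conjugacy classes inside a division: the SIGN of the exceptional term.  HONEST FRAMING: the value of this file
is a THEOREM (kernel-checked) — NOT summit progress.

Setting: a cyclic extension `N|E` of number fields with group of order `m`, the Hecke data of
`CyclicExtension.exists_primitive_heckeFactorisation` (faithful `χ₁`, primitive ray class characters
`χ_j mod 𝔣_j` with `χ_j(v) = χ₁(Frob v)^j` at the primes `v` unramified in `N`, entire continuations `L_j`,
orders of vanishing adding up: `ord ζ₁_N = ord ζ₁_E + Σ_{0<j<m} ord L_j`).

* `heckeIndex_conj_zero` — if `0 < j₀ < m` and `L_{j₀}(β) = 0` at a REAL point `β > 0`, then also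
  `L_{m−j₀}(β) = 0`: the character `χ_{m−j₀}` agrees with `conj χ_{j₀}` at every prime unramified in `N`
  (`χ₁(Frob)^{m−j} = conj χ₁(Frob)^j`), so the two `L`-series `mod 𝔣_{j₀}𝔣_{m−j₀}(d_N)` coincide
  (`rayClassLSeries_congr`), they differ from `L(χ̄_{j₀}, s)`, `L(χ_{m−j₀}, s)` by finitely many Euler
  factors non-vanishing on `re s > 0` (`rayClassLSeries_eq_mul_prod`), and `L(χ̄, β) = conj L(χ, β)`
  (`rayClassLSeries_continuation_conj_eq`); identity theorem.
* `heckeIndex_two_mul_eq` — if moreover `β` is a SIMPLE zero of `ζ₁_N`, then `2 j₀ = m` (otherwise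
  `L_{j₀}` and `L_{m−j₀}` both vanish at `β`, order `≥ 2`); hence `χ₁(τ)^{j₀} = ±1` for every `τ`
  (`heckeIndex_pow_sq_eq_one`) — the character carrying the exceptional zero is REAL, as in
  [LagariasMontgomeryOdlyzko1979, Thm. 1.1: "χ₁ real"]; and `ζ₁_E(β) ≠ 0` (`heckeIndex_dedekindZeta₁_ne_zero`).
* `dedekindZeta₁_eq_zero_of_order_one` — the case `j₀ = 0`.

References: [LagariasMontgomeryOdlyzko1979, §7, Thm. 1.1]; [NeukirchANT1999, VII §8, §10].
-/

noncomputable section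

open Complex Real Finset NumberField IsDedekindDomain Filter Topology
open scoped NumberField nonZeroDivisors Classical ComplexConjugate

namespace Summit.QuantumAdvantage.QuantumAdvantage.Theorems.DegreeOnePrimesEscape

open Literature.NumberTheory.LFunctions Literature.NumberTheory.LFunctions.NumberField
  Literature.NumberTheory.GaloisRepresentations

variable {E N : Type} [Field E] [NumberField E] [Field N] [NumberField N] [Algebra E N] [IsGalois E N]

/-! ### Small analytic helpers -/

omit [NumberField E] [NumberField N] [Algebra E N] [IsGalois E N] in
/-- For an entire `f` with `f z₁ ≠ 0` somewhere: `f z₀ = 0 → 1 ≤ analyticOrderNatAt f z₀`. -/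
theorem one_le_analyticOrderNatAt_of_eq_zero {f : ℂ → ℂ} (hf : Differentiable ℂ f) {z₁ : ℂ}
    (hz₁ : f z₁ ≠ 0) {z₀ : ℂ} (hz₀ : f z₀ = 0) : 1 ≤ analyticOrderNatAt f z₀ := by
  have htop := Literature.NumberTheory.LFunctions.EntireEF.analyticOrderAt_ne_top_of_entire hf hz₁ z₀
  have hne : analyticOrderAt f z₀ ≠ 0 := (hf.analyticAt z₀).analyticOrderAt_ne_zero.mpr hz₀
  have : analyticOrderNatAt f z₀ ≠ 0 := by
    rw [analyticOrderNatAt, ne_eq, ENat.toNat_eq_zero]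
    push Not
    exact ⟨hne, htop⟩
  omega

omit [NumberField E] [NumberField N] [Algebra E N] [IsGalois E N] in
/-- For an entire `f` with `f z₁ ≠ 0` somewhere: `analyticOrderNatAt f z₀ = 0 → f z₀ ≠ 0`. -/
theorem ne_zero_of_analyticOrderNatAt_eq_zero {f : ℂ → ℂ} (hf : Differentiable ℂ f) {z₁ : ℂ}
    (hz₁ : f z₁ ≠ 0) {z₀ : ℂ} (h0 : analyticOrderNatAt f z₀ = 0) : f z₀ ≠ 0 := by
  intro hz₀
  have := one_le_analyticOrderNatAt_of_eq_zero hf hz₁ hz₀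
  omega

omit [NumberField E] [NumberField N] [Algebra E N] [IsGalois E N] in
/-- `s ↦ (n : ℂ)^(−s)` is entire for `n ≠ 0`. -/
theorem differentiable_natCast_cpow_neg {n : ℕ} (hn : n ≠ 0) :
    Differentiable ℂ fun s : ℂ ↦ (n : ℂ) ^ (-s) :=
  differentiable_id.neg.const_cpow (Or.inl (by exact_mod_cast hn))

omit [Algebra E N] [IsGalois E N] [NumberField N] in
/-- The Euler factor `1 − ψ(v) N v^{−s}` does not vanish for `re s > 0` when `‖ψ v‖ ≤ 1`. -/
theorem eulerFactor_ne_zero (v : HeightOneSpectrum (𝓞 E)) {a : ℂ} (ha : ‖a‖ ≤ 1) {s : ℂ} (hs : 0 < s.re) :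
    1 - a * ((Ideal.absNorm v.asIdeal : ℕ) : ℂ) ^ (-s) ≠ 0 := by
  have hne0 : Ideal.absNorm v.asIdeal ≠ 0 := Ideal.absNorm_eq_zero_iff.not.mpr v.ne_bot
  have hne1 : Ideal.absNorm v.asIdeal ≠ 1 := Ideal.absNorm_eq_one_iff.not.mpr v.isPrime.ne_top
  have hN1nat : 1 < Ideal.absNorm v.asIdeal := by omega
  have hN1 : (1 : ℝ) < Ideal.absNorm v.asIdeal := by exact_mod_cast hN1nat
  have hN0 : 0 < Ideal.absNorm v.asIdeal := by omega
  have hlt : ‖a * ((Ideal.absNorm v.asIdeal : ℕ) : ℂ) ^ (-s)‖ < 1 := by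
    rw [norm_mul, Complex.norm_natCast_cpow_of_pos hN0, Complex.neg_re]
    have h2 : ((Ideal.absNorm v.asIdeal : ℕ) : ℝ) ^ (-s.re) < 1 :=
      Real.rpow_lt_one_of_one_lt_of_neg hN1 (by linarith)
    have h3 : 0 ≤ ((Ideal.absNorm v.asIdeal : ℕ) : ℝ) ^ (-s.re) := Real.rpow_nonneg (by positivity) _
    nlinarith [norm_nonneg a]
  intro h0
  have : a * ((Ideal.absNorm v.asIdeal : ℕ) : ℂ) ^ (-s) = 1 := by linear_combination -h0
  rw [this, norm_one] at hlt
  exact lt_irrefl _ hlt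

/-! ### Values of `χ₁ ∘ Frob`: `m`-th roots of unity -/

omit [NumberField E] [NumberField N] [IsGalois E N] in
/-- `χ₁(g)^m = 1` for a character of a finite group of order `m`. -/
theorem character_pow_card_eq_one (χ₁ : (N ≃ₐ[E] N) →* ℂˣ) [Finite (N ≃ₐ[E] N)] {m : ℕ}
    (hcard : Nat.card (N ≃ₐ[E] N) = m) (g : N ≃ₐ[E] N) : ((χ₁ g : ℂˣ) : ℂ) ^ m = 1 := by
  rw [← Units.val_pow_eq_pow_val, ← map_pow, ← hcard, pow_card_eq_one', map_one, Units.val_one]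

omit [NumberField E] [NumberField N] [IsGalois E N] in
/-- `‖χ₁(g)‖ = 1`. -/
theorem norm_character_eq_one (χ₁ : (N ≃ₐ[E] N) →* ℂˣ) [Finite (N ≃ₐ[E] N)] (g : N ≃ₐ[E] N) :
    ‖((χ₁ g : ℂˣ) : ℂ)‖ = 1 := by
  have h := character_pow_card_eq_one χ₁ rfl g
  have hm : Nat.card (N ≃ₐ[E] N) ≠ 0 := Nat.card_pos.ne'
  have := congrArg norm h
  rw [norm_pow, norm_one] at this
  exact (pow_eq_one_iff_of_nonneg (norm_nonneg _) hm).mp this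

omit [NumberField E] [NumberField N] [IsGalois E N] in
/-- `conj (χ₁(g)^j) = χ₁(g)^{m − j}` for `j ≤ m = |G|`. -/
theorem conj_character_pow_eq (χ₁ : (N ≃ₐ[E] N) →* ℂˣ) [Finite (N ≃ₐ[E] N)] {m : ℕ}
    (hcard : Nat.card (N ≃ₐ[E] N) = m) (g : N ≃ₐ[E] N) {j : ℕ} (hj : j ≤ m) :
    conj (((χ₁ g : ℂˣ) : ℂ) ^ j) = ((χ₁ g : ℂˣ) : ℂ) ^ (m - j) := by
  set u : ℂ := ((χ₁ g : ℂˣ) : ℂ) with hu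
  have hu1 : ‖u‖ = 1 := norm_character_eq_one χ₁ g
  have hum : u ^ m = 1 := character_pow_card_eq_one χ₁ hcard g
  have hu0 : u ≠ 0 := fun h ↦ by rw [h, norm_zero] at hu1; exact zero_ne_one hu1
  rw [map_pow, ← Complex.inv_eq_conj hu1]
  have hsplit : u ^ (m - j) * u ^ j = 1 := by rw [← pow_add, Nat.sub_add_cancel hj, hum]
  rw [inv_pow]
  exact (eq_inv_of_mul_eq_one_left hsplit).symm

/-! ### The conjugate index -/

/-- **`L_{j₀}(β) = 0 ⟹ L_{m−j₀}(β) = 0` at a real point `β > 0`** (see the module docstring).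
[cite: LagariasMontgomeryOdlyzko1979, §7] -/
theorem heckeIndex_conj_zero [IsCyclic (N ≃ₐ[E] N)] {m : ℕ} (hcard : Nat.card (N ≃ₐ[E] N) = m)
    (χ₁ : (N ≃ₐ[E] N) →* ℂˣ) (𝔣 : ℕ → Ideal (𝓞 E)) (χ : ℕ → HeightOneSpectrum (𝓞 E) → ℂ)
    (p : ℕ → Finset {w : InfinitePlace E // w.IsReal}) (L : ℕ → ℂ → ℂ)
    (hdata : ∀ j, 𝔣 j ≠ ⊥ ∧ IsRayClassCharacter (𝔣 j) (χ j) ∧ IsPrimitive (𝔣 j) (χ j) ∧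
      IsSignType (𝔣 j) (χ j) (p j))
    (hval : ∀ (j : ℕ) (v : HeightOneSpectrum (𝓞 E)), Algebra.IsUnramifiedIn (𝓞 N) v.asIdeal →
      χ j v = ((χ₁ (galFrob E N v) : ℂˣ) : ℂ) ^ j)
    (hnt : ∀ j ∈ Finset.Ico 1 m, ∃ v : HeightOneSpectrum (𝓞 E), ¬ 𝔣 j ≤ v.asIdeal ∧ χ j v ≠ 1)
    (hL : ∀ j ∈ Finset.Ico 1 m, Differentiable ℂ (L j) ∧ ∀ s : ℂ, 1 < s.re → L j s = rayClassLSeries (𝔣 j) (χ j) s)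
    {β : ℝ} (hβ : 0 < β) {j₀ : ℕ} (hj₀ : j₀ ∈ Finset.Ico 1 m) (hzero : L j₀ β = 0) :
    L (m - j₀) β = 0 := by
  classical
  rw [Finset.mem_Ico] at hj₀
  obtain ⟨hj₀1, hj₀m⟩ := hj₀
  set j' : ℕ := m - j₀ with hj'
  have hj'mem : j' ∈ Finset.Ico 1 m := by rw [Finset.mem_Ico]; omega
  have hj₀mem : j₀ ∈ Finset.Ico 1 m := by rw [Finset.mem_Ico]; omega
  obtain ⟨hL₀d, hL₀s⟩ := hL j₀ hj₀mem
  obtain ⟨hL'd, hL's⟩ := hL j' hj'mem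
  have h𝔣₀ : 𝔣 j₀ ≠ ⊥ := (hdata j₀).1
  have h𝔣' : 𝔣 j' ≠ ⊥ := (hdata j').1
  have hray₀ : IsRayClassCharacter (𝔣 j₀) (χ j₀) := (hdata j₀).2.1
  have hray' : IsRayClassCharacter (𝔣 j') (χ j') := (hdata j').2.1
  -- the conjugate character and its entire continuation
  set ψ₁ : HeightOneSpectrum (𝓞 E) → ℂ := fun v ↦ conj (χ j₀ v) with hψ₁
  have hψ₁le : ∀ v : HeightOneSpectrum (𝓞 E), ¬ 𝔣 j₀ ≤ v.asIdeal → ‖ψ₁ v‖ ≤ 1 := fun v hv ↦ by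
    rw [hψ₁]; dsimp only; rw [Complex.norm_conj]; exact (hray₀.norm_eq_one v hv).le
  have hχ₀le : ∀ v : HeightOneSpectrum (𝓞 E), ¬ 𝔣 j₀ ≤ v.asIdeal → ‖χ j₀ v‖ ≤ 1 := fun v hv ↦
    (hray₀.norm_eq_one v hv).le
  have hχ'le : ∀ v : HeightOneSpectrum (𝓞 E), ¬ 𝔣 j' ≤ v.asIdeal → ‖χ j' v‖ ≤ 1 := fun v hv ↦
    (hray'.norm_eq_one v hv).le
  have hnt₁ : ∃ v : HeightOneSpectrum (𝓞 E), ¬ 𝔣 j₀ ≤ v.asIdeal ∧ ψ₁ v ≠ 1 := by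
    obtain ⟨v, hv, hv1⟩ := hnt j₀ hj₀mem
    refine ⟨v, hv, fun h ↦ hv1 ?_⟩
    have := congrArg conj h
    rwa [hψ₁, Complex.conj_conj, map_one] at this
  obtain ⟨L₁, hL₁d, hL₁s⟩ := exists_differentiable_eq_rayClassLSeries h𝔣₀ hray₀.conj hnt₁
  -- `L₁(β) = conj L_{j₀}(β) = 0`
  have hL₁β : L₁ β = 0 := by
    have h := rayClassLSeries_continuation_conj_eq h𝔣₀ hχ₀le hL₀d hL₀s hL₁d hL₁s (β : ℂ)
    rw [h, Complex.conj_ofReal, hzero, map_zero]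
  -- the auxiliary moduli
  set dN : 𝓞 E := ((NumberField.discr N).natAbs : 𝓞 E) with hdN
  have hdNne : dN ≠ 0 := by
    rw [hdN]; exact_mod_cast Int.natAbs_ne_zero.mpr (NumberField.discr_ne_zero N)
  set 𝔡 : Ideal (𝓞 E) := Ideal.span {dN} with h𝔡
  have h𝔡0 : 𝔡 ≠ ⊥ := by rw [h𝔡, ne_eq, Ideal.span_singleton_eq_bot]; exact hdNne
  set 𝔪₁ : Ideal (𝓞 E) := 𝔣 j' * 𝔡 with h𝔪₁
  set 𝔪₂ : Ideal (𝓞 E) := 𝔣 j₀ * 𝔡 with h𝔪₂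
  have h𝔪₁0 : 𝔪₁ ≠ ⊥ := mul_ne_zero h𝔣' h𝔡0
  have h𝔪₂0 : 𝔪₂ ≠ ⊥ := mul_ne_zero h𝔣₀ h𝔡0
  set 𝔐 : Ideal (𝓞 E) := 𝔣 j₀ * 𝔪₁ with h𝔐
  have h𝔐' : 𝔣 j' * 𝔪₂ = 𝔐 := by rw [h𝔐, h𝔪₁, h𝔪₂]; exact mul_left_comm _ _ _
  have h𝔐0 : 𝔐 ≠ ⊥ := mul_ne_zero h𝔣₀ h𝔪₁0
  have h𝔐le : 𝔐 ≤ 𝔡 := by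
    rw [h𝔐, h𝔪₁, ← mul_assoc]; exact Ideal.mul_le_left
  -- off `𝔐` every prime is unramified in `N`, so `ψ₁ = χ_{j'}` there
  have hunr : ∀ v : HeightOneSpectrum (𝓞 E), ¬ 𝔐 ≤ v.asIdeal → Algebra.IsUnramifiedIn (𝓞 N) v.asIdeal := by
    intro v hv
    by_contra hram
    obtain ⟨q, hq, hqv, -⟩ := exists_prime_mem (E := E) v
    have hdvd : (q : ℤ) ∣ NumberField.discr N := dvd_discr_of_not_isUnramifiedIn (N := N) v hq hqv hram
    have hdvd' : q ∣ (NumberField.discr N).natAbs := by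
      have := Int.natAbs_dvd_natAbs.mpr hdvd
      rwa [Int.natAbs_natCast] at this
    obtain ⟨k, hk⟩ := hdvd'
    have hmem : dN ∈ v.asIdeal := by
      rw [hdN, hk, Nat.cast_mul]; exact v.asIdeal.mul_mem_right _ hqv
    apply hv
    refine h𝔐le.trans ?_
    rw [h𝔡, Ideal.span_le, Set.singleton_subset_iff]
    exact hmem
  have hagree : ∀ v : HeightOneSpectrum (𝓞 E), ¬ 𝔐 ≤ v.asIdeal → ψ₁ v = χ j' v := by
    intro v hv
    have hu := hunr v hv
    rw [hψ₁]; dsimp only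
    rw [hval j₀ v hu, hval j' v hu, hj']
    exact conj_character_pow_eq χ₁ hcard (galFrob E N v) hj₀m.le
  -- the finite sets of exceptional primes
  obtain ⟨S₁, hS₁⟩ := exists_finset_primes_le_and_not_le (𝔪₁ := 𝔣 j₀) h𝔪₁0
  obtain ⟨S₂, hS₂⟩ := exists_finset_primes_le_and_not_le (𝔪₁ := 𝔣 j') h𝔪₂0
  set P₁ : ℂ → ℂ := fun s ↦ ∏ v ∈ S₁, (1 - ψ₁ v * ((Ideal.absNorm v.asIdeal : ℕ) : ℂ) ^ (-s)) with hP₁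
  set P₂ : ℂ → ℂ := fun s ↦ ∏ v ∈ S₂, (1 - χ j' v * ((Ideal.absNorm v.asIdeal : ℕ) : ℂ) ^ (-s)) with hP₂
  have hP₁d : Differentiable ℂ P₁ := by
    refine Differentiable.fun_finsetProd fun v _ ↦ ?_
    exact (differentiable_const _).sub ((differentiable_const _).mul
      (differentiable_natCast_cpow_neg (Ideal.absNorm_eq_zero_iff.not.mpr v.ne_bot)))
  have hP₂d : Differentiable ℂ P₂ := by
    refine Differentiable.fun_finsetProd fun v _ ↦ ?_
    exact (differentiable_const _).sub ((differentiable_const _).mul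
      (differentiable_natCast_cpow_neg (Ideal.absNorm_eq_zero_iff.not.mpr v.ne_bot)))
  have hP₁ne : ∀ s : ℂ, 0 < s.re → P₁ s ≠ 0 := by
    intro s hs
    rw [hP₁]; dsimp only
    rw [Finset.prod_ne_zero_iff]
    intro v hv
    exact eulerFactor_ne_zero v (hψ₁le v ((hS₁ v).mp hv).2) hs
  have hP₂ne : ∀ s : ℂ, 0 < s.re → P₂ s ≠ 0 := by
    intro s hs
    rw [hP₂]; dsimp only
    rw [Finset.prod_ne_zero_iff]
    intro v hv
    exact eulerFactor_ne_zero v (hχ'le v ((hS₂ v).mp hv).2) hs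
  -- the identity `L₁ P₁ = L_{j'} P₂` on `re s > 1`
  have hident : ∀ s : ℂ, 1 < s.re → L₁ s * P₁ s = L j' s * P₂ s := by
    intro s hs
    have hs0 : 0 < s.re := by linarith
    have e1 := rayClassLSeries_eq_mul_prod h𝔣₀ h𝔪₁0 hψ₁le hs hS₁
    have e2 := rayClassLSeries_eq_mul_prod h𝔣' h𝔪₂0 hχ'le hs hS₂
    have emid : rayClassLSeries (𝔣 j₀ * 𝔪₁) ψ₁ s = rayClassLSeries (𝔣 j' * 𝔪₂) (χ j') s := by
      rw [h𝔐', ← h𝔐]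
      exact rayClassLSeries_congr h𝔐0 hagree s
    have hinv1 : (∏ v ∈ S₁, (1 - ψ₁ v * ((Ideal.absNorm v.asIdeal : ℕ) : ℂ) ^ (-s))⁻¹) * P₁ s = 1 := by
      rw [hP₁]; dsimp only
      rw [Finset.prod_inv_distrib, inv_mul_cancel₀ (hP₁ne s hs0)]
    have hinv2 : (∏ v ∈ S₂, (1 - χ j' v * ((Ideal.absNorm v.asIdeal : ℕ) : ℂ) ^ (-s))⁻¹) * P₂ s = 1 := by
      rw [hP₂]; dsimp only
      rw [Finset.prod_inv_distrib, inv_mul_cancel₀ (hP₂ne s hs0)]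
    calc L₁ s * P₁ s = rayClassLSeries (𝔣 j₀) ψ₁ s * P₁ s := by rw [hL₁s s hs]
      _ = rayClassLSeries (𝔣 j₀ * 𝔪₁) ψ₁ s *
            ((∏ v ∈ S₁, (1 - ψ₁ v * ((Ideal.absNorm v.asIdeal : ℕ) : ℂ) ^ (-s))⁻¹) * P₁ s) := by
          rw [e1, mul_assoc]
      _ = rayClassLSeries (𝔣 j' * 𝔪₂) (χ j') s *
            ((∏ v ∈ S₂, (1 - χ j' v * ((Ideal.absNorm v.asIdeal : ℕ) : ℂ) ^ (-s))⁻¹) * P₂ s) := by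
          rw [hinv1, emid, hinv2]
      _ = rayClassLSeries (𝔣 j') (χ j') s * P₂ s := by rw [e2, mul_assoc]
      _ = L j' s * P₂ s := by rw [hL's s hs]
  -- identity theorem on `ℂ`
  have hentire : ∀ s : ℂ, L₁ s * P₁ s = L j' s * P₂ s := by
    have han₁ : AnalyticOnNhd ℂ (fun s ↦ L₁ s * P₁ s) Set.univ := fun z _ ↦
      ((hL₁d.mul hP₁d).analyticAt z)
    have han₂ : AnalyticOnNhd ℂ (fun s ↦ L j' s * P₂ s) Set.univ := fun z _ ↦
      ((hL'd.mul hP₂d).analyticAt z)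
    have hev : (fun s ↦ L₁ s * P₁ s) =ᶠ[𝓝 (2 : ℂ)] fun s ↦ L j' s * P₂ s := by
      have hopen : IsOpen {z : ℂ | 1 < z.re} := isOpen_lt continuous_const Complex.continuous_re
      filter_upwards [hopen.mem_nhds (by norm_num : (1 : ℝ) < (2 : ℂ).re)] with z hz
      exact hident z hz
    intro s
    exact han₁.eqOn_of_preconnected_of_eventuallyEq han₂ isPreconnected_univ (Set.mem_univ 2) hev
      (Set.mem_univ s)
  have hβre : 0 < ((β : ℂ)).re := by rwa [Complex.ofReal_re]
  have key := hentire β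
  rw [hL₁β, zero_mul] at key
  exact (mul_eq_zero.mp key.symm).resolve_right (hP₂ne β hβre)

/-- **The exceptional index is real: `2 j₀ = m`.**  If `β > 0` is a SIMPLE zero of `ζ₁_N` and
`L_{j₀}(β) = 0` with `0 < j₀ < m`, then `m = 2 j₀`. [cite: LagariasMontgomeryOdlyzko1979, Theorem 1.1] -/
theorem heckeIndex_two_mul_eq [IsCyclic (N ≃ₐ[E] N)] {m : ℕ} (hcard : Nat.card (N ≃ₐ[E] N) = m)
    (χ₁ : (N ≃ₐ[E] N) →* ℂˣ) (𝔣 : ℕ → Ideal (𝓞 E)) (χ : ℕ → HeightOneSpectrum (𝓞 E) → ℂ)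
    (p : ℕ → Finset {w : InfinitePlace E // w.IsReal}) (L : ℕ → ℂ → ℂ)
    (hdata : ∀ j, 𝔣 j ≠ ⊥ ∧ IsRayClassCharacter (𝔣 j) (χ j) ∧ IsPrimitive (𝔣 j) (χ j) ∧
      IsSignType (𝔣 j) (χ j) (p j))
    (hval : ∀ (j : ℕ) (v : HeightOneSpectrum (𝓞 E)), Algebra.IsUnramifiedIn (𝓞 N) v.asIdeal →
      χ j v = ((χ₁ (galFrob E N v) : ℂˣ) : ℂ) ^ j)
    (hnt : ∀ j ∈ Finset.Ico 1 m, ∃ v : HeightOneSpectrum (𝓞 E), ¬ 𝔣 j ≤ v.asIdeal ∧ χ j v ≠ 1)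
    (hL : ∀ j ∈ Finset.Ico 1 m, Differentiable ℂ (L j) ∧ ∀ s : ℂ, 1 < s.re → L j s = rayClassLSeries (𝔣 j) (χ j) s)
    (hord : ∀ ρ : ℂ, analyticOrderNatAt (dedekindZeta₁ N) ρ =
      analyticOrderNatAt (dedekindZeta₁ E) ρ + ∑ j ∈ Finset.Ico 1 m, analyticOrderNatAt (L j) ρ)
    {β : ℝ} (hβ : 0 < β) (hsimple : analyticOrderNatAt (dedekindZeta₁ N) β = 1)
    {j₀ : ℕ} (hj₀ : j₀ ∈ Finset.Ico 1 m) (hzero : L j₀ β = 0) : 2 * j₀ = m := by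
  classical
  have hconj := heckeIndex_conj_zero hcard χ₁ 𝔣 χ p L hdata hval hnt hL hβ hj₀ hzero
  have hj₀' := Finset.mem_Ico.mp hj₀
  set j' : ℕ := m - j₀ with hj'
  have hj'mem : j' ∈ Finset.Ico 1 m := by rw [Finset.mem_Ico]; omega
  by_contra hne
  have hjj : j₀ ≠ j' := by omega
  -- both `L_{j₀}` and `L_{j'}` vanish at `β`, each of order `≥ 1`
  have hone : ∀ j ∈ Finset.Ico 1 m, L j β = 0 → 1 ≤ analyticOrderNatAt (L j) β := by
    intro j hj hz
    obtain ⟨hLd, hLs⟩ := hL j hj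
    have h1 : L j 1 ≠ 0 :=
      rayClassLSeries_entire_apply_one_ne_zero (hdata j).1 (hdata j).2.1 (hnt j hj) hLd hLs
    exact one_le_analyticOrderNatAt_of_eq_zero hLd h1 hz
  have h₀ := hone j₀ hj₀ hzero
  have h' := hone j' hj'mem hconj
  have hsum : 2 ≤ ∑ j ∈ Finset.Ico 1 m, analyticOrderNatAt (L j) (β : ℂ) := by
    have hsub : ({j₀, j'} : Finset ℕ) ⊆ Finset.Ico 1 m := by
      intro j hj
      rw [Finset.mem_insert, Finset.mem_singleton] at hj
      rcases hj with rfl | rfl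
      · exact hj₀
      · exact hj'mem
    have hle := Finset.sum_le_sum_of_subset (f := fun j ↦ analyticOrderNatAt (L j) (β : ℂ)) hsub
    rw [Finset.sum_pair hjj] at hle
    omega
  have htot := hord β
  rw [hsimple] at htot
  omega

omit [NumberField E] [NumberField N] [IsGalois E N] in
/-- **Consequence: `χ₁(τ)^{j₀} = ±1`**, i.e. `(χ₁(τ)^{j₀})² = 1`, when `2 j₀ = m = |Gal(N|E)|`. -/
theorem character_pow_sq_eq_one_of_two_mul (χ₁ : (N ≃ₐ[E] N) →* ℂˣ) [Finite (N ≃ₐ[E] N)] {m j₀ : ℕ}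
    (hcard : Nat.card (N ≃ₐ[E] N) = m) (h2 : 2 * j₀ = m) (τ : N ≃ₐ[E] N) :
    (((χ₁ τ : ℂˣ) : ℂ) ^ j₀) ^ 2 = 1 := by
  rw [← pow_mul, mul_comm, h2]
  exact character_pow_card_eq_one χ₁ hcard τ

omit [NumberField E] [NumberField N] [IsGalois E N] in
/-- A complex number with `z² = 1` is `±1`; in particular it is real and `(z⁻¹)` has real part `±1`:
here in the form used downstream, `(re (z⁻¹ ^ j))` for `z = χ₁ τ` — we record `z ^ j = 1 ∨ z ^ j = -1`. -/
theorem pow_eq_one_or_neg_one_of_sq {z : ℂ} (h : z ^ 2 = 1) : z = 1 ∨ z = -1 := by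
  have : (z - 1) * (z + 1) = 0 := by linear_combination h
  rcases mul_eq_zero.mp this with h1 | h1
  · left; linear_combination h1
  · right; linear_combination h1

omit [Algebra E N] [IsGalois E N] in
/-- **The factor `ζ₁_E` does not carry the exceptional zero when `j₀ > 0`**: if `β` is a simple zero of
`ζ₁_N` and `L_{j₀}(β) = 0` for some `0 < j₀ < m`, then `ζ₁_E(β) ≠ 0`. -/
theorem heckeIndex_dedekindZeta₁_ne_zero {m : ℕ} (𝔣 : ℕ → Ideal (𝓞 E))
    (χ : ℕ → HeightOneSpectrum (𝓞 E) → ℂ) (L : ℕ → ℂ → ℂ)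
    (hdata : ∀ j, 𝔣 j ≠ ⊥ ∧ IsRayClassCharacter (𝔣 j) (χ j))
    (hnt : ∀ j ∈ Finset.Ico 1 m, ∃ v : HeightOneSpectrum (𝓞 E), ¬ 𝔣 j ≤ v.asIdeal ∧ χ j v ≠ 1)
    (hL : ∀ j ∈ Finset.Ico 1 m, Differentiable ℂ (L j) ∧ ∀ s : ℂ, 1 < s.re → L j s = rayClassLSeries (𝔣 j) (χ j) s)
    (hord : ∀ ρ : ℂ, analyticOrderNatAt (dedekindZeta₁ N) ρ =
      analyticOrderNatAt (dedekindZeta₁ E) ρ + ∑ j ∈ Finset.Ico 1 m, analyticOrderNatAt (L j) ρ)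
    {β : ℝ} (hsimple : analyticOrderNatAt (dedekindZeta₁ N) β = 1)
    {j₀ : ℕ} (hj₀ : j₀ ∈ Finset.Ico 1 m) (hzero : L j₀ β = 0) : dedekindZeta₁ E β ≠ 0 := by
  classical
  obtain ⟨hLd, hLs⟩ := hL j₀ hj₀
  have h1 : L j₀ 1 ≠ 0 :=
    rayClassLSeries_entire_apply_one_ne_zero (hdata j₀).1 (hdata j₀).2 (hnt j₀ hj₀) hLd hLs
  have hj : 1 ≤ analyticOrderNatAt (L j₀) (β : ℂ) := one_le_analyticOrderNatAt_of_eq_zero hLd h1 hzero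
  have hsum : 1 ≤ ∑ j ∈ Finset.Ico 1 m, analyticOrderNatAt (L j) (β : ℂ) :=
    hj.trans (Finset.single_le_sum (f := fun j ↦ analyticOrderNatAt (L j) (β : ℂ)) (fun _ _ ↦ Nat.zero_le _) hj₀)
  have htot := hord β
  rw [hsimple] at htot
  have hE0 : analyticOrderNatAt (dedekindZeta₁ E) (β : ℂ) = 0 := by omega
  have hE2 : dedekindZeta₁ E 2 ≠ 0 := by
    rw [dedekindZeta₁_apply_eq_mul (by norm_num : 1 < (2 : ℂ).re)]
    exact mul_ne_zero (by norm_num) (NumberField.dedekindZeta_ne_zero_of_one_lt_re E (by norm_num))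
  exact ne_zero_of_analyticOrderNatAt_eq_zero (dedekindZeta₁_differentiable E) hE2 hE0

omit [NumberField N] [Algebra E N] [IsGalois E N] in
/-- **The case `j₀ = 0`**: `analyticOrderNatAt ζ₁_E β = 1 ⟹ ζ₁_E(β) = 0`. -/
theorem dedekindZeta₁_eq_zero_of_order_one {β : ℝ} (h : analyticOrderNatAt (dedekindZeta₁ E) β = 1) :
    dedekindZeta₁ E β = 0 :=
  apply_eq_zero_of_analyticOrderNatAt_ne_zero (by rw [h]; exact one_ne_zero)

end Summit.QuantumAdvantage.QuantumAdvantage.Theorems.DegreeOnePrimesEscape
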